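import Summits.ABC.IUTFork.Joshi.ATS4DescentSpineGenuineResidualSupp
import HarnessLib

/-!
# [J-IV] (arXiv:2403.10430v2) §6.10–§7.1: in the ∃-form E5 spine the LOCAL HULL LOG-VOLUMES are ELIMINABLE — (R4) «Step (v) per prime» ∧
# (R5) «lower bound at φ(y₀)» ⟺ ONE vol-free inequality; at free `d_{L′}`/`q` components ⟺ ONE GLOBAL Thm-1.10-shaped inequality
# (R-J census row Y-21, parent word — counted reader's precision rider)

Proof-only companion (0 defs) of the abc-iut cell, sub-cell R-J «JOSHI Y-DISCHARGE CENSUS» (rung LADDER-ABC:A2.RESCUE.J), to abc-iut-E-t33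
gen 6's `Joshi/ATS4DescentSpineGenuineResidual.lean` (p464392) / `…Supp.lean` (p464845); seat abc-iut-E-t50 (gen 8; the row's second
counted reader — riders B1–B3 of HOME/plan/E/t50/audit/AUDIT-Y21parent-p464392-p464845.md, kernel-checked there first; precision P1
UPHELD and the parent word re-typed by abc-iut-E-plan 21:01:14Z, GO on this file). Parents BUILT, every
input BY NAME; nothing of E-t33 / E-t31 / E-t30 restated.

E-t33's `abc_of_genuineResidual` proves `ABC` from the RESIDUAL PACKAGE per admissible `(λ, ℓ)`: (R1) a genuine theta tower + `L_mod`,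
(R2) a three-way finite `V = V^dst_ℚ`, (R3) FREE real `v_ℚ`-components `DLp`, `qAt` of `log d_{L′}`, `log 𝔮_F` with their SUMS fixed,
(R4) FREE local hull log-volumes `vol p` (`p ∈ V`), `vol_∞` with [IUTchIV] Step (v) at each `p ∈ V` in Prop. 6.10.9's shape
`−(1/ℓ⋆)·|vol p| ≤ B_p`, `B_p := ((ℓ+1)/4)·{(1+4/ℓ)·DLp p − (1/6)·qAt p + (4/ℓ)·log p + (20/3)·e*_mod·ι_p·(log p)/p}`, and (R5) the
lower bound `−(1/2ℓ)·log 𝔮_F ≤ −(1/ℓ⋆)·(Σ_{p∈V} |vol p| + |vol_∞|)`. WHAT IS HERE (all PROVED; theorems only; standard axioms):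
* `residual_iff_volFree` — for `ℓ ≥ 2`, ANY finite `V`, ANY reals `B_p`, `Q`: `(∃ vol vol_∞, (R4) ∧ (R5)) ⟺ Σ_{p∈V} max(0, −B_p) ≤ (1/2ℓ)·Q`
  (forwards `max(0,−B_p) ≤ (1/ℓ⋆)|vol p|`, sum, (R5); backwards `vol p := ℓ⋆·max(0, −B_p)`, `vol_∞ := 0`). Pure real arithmetic. [folklore]
* `abc_of_volFreeResidual` — hence `abc_of_genuineResidual` HOLDS with (R4) ∧ (R5) REPLACED by that ONE vol-free inequality (`Q := log 𝔮_F`):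
  the local hull log-volumes are FREE INTERMEDIARIES of the ∃-form spine (E-t33's theorem BY NAME through `residual_iff_volFree`).
* `abc_of_volFreeResidualSupport` — the same elimination at GENUINE components (`abc_of_genuineResidualSupport`): residual = the
  per-prime positive-part sum at the genuine brackets; here the per-prime Step (v) shape stays load-bearing.
* `sum_balance` — bookkeeping: balancing a prescribed sum on `V ∋ p₀` against nonnegative per-prime terms. [folklore]
* `globalInequality_of_residual` — conversely (R3) ∧ (R4) ∧ (R5) ⟹ that global inequality (sum Step (v), insert the sums, chain with
  the lower bound): the two antecedents are EQUIVALENT per point. [folklore]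
* `abc_of_globalInequality` — because (R3) fixes only the SUMS of the free components, the per-prime positive terms can be balanced away
  (`DLp p := −pos_p/(1+4/ℓ) < 0` off one prime — permitted by the typing, absurd for genuine components): `abc_of_genuineResidual` holds with
  (R3) ∧ (R4) ∧ (R5) replaced by ONE GLOBAL inequality per admissible point on a non-empty three-way `V`,
  `−(1/2ℓ)·log 𝔮_F ≤ ((ℓ+1)/4)·{(1+4/ℓ)·logDifferent K − (1/6)·log 𝔮_F + (4/ℓ)·Σ_{p∈V} log p + (20/3)·e*_mod·Σ_{p∈V} ι_p·(log p)/p}` —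
  the summed Step (v) ∘ (6.11.1) ∘ lower bound, i.e. [J-IV] (6.11.2)'s / [IUTchIV] Thm. 1.10's displayed SHAPE between GENUINE invariants of the
  tower, with no volume and no per-prime datum. (At GENUINE components — E-t33's `abc_of_genuineResidualSupport` / `…_reading3` — the
  balancing is unavailable; `residual_iff_volFree` still eliminates the volumes there, leaving the per-prime positive-part sum
  `Σ_p max(0, −B_p) ≤ (1/2ℓ)·log 𝔮_F` at the genuine `B_p` — `abc_of_volFreeResidualSupport` below.)
READING (the census rider, E-plan's pen): the residual of the ∃-form spine at genuine readings is ONE real inequality per point — at free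
components the GLOBAL Thm-1.10-shaped one —; the per-prime Step (v) SHAPE is load-bearing only at genuine components; Joshi's §6.6–§6.11
contributes constants and bookkeeping, and `ABC` is reached from the global inequality by the classical reduction the tree already holds
(E-t33's `thm721_of_thm611OnLambdaLine` ∘ `abc_of_thm721`, E-t30's off-`Exc` layer). An implication with a WEAKER antecedent is a STRONGER
theorem: nothing here is a defect of p464392.

SOURCE locators as in the parents (cell render `HOME/lit/renders/Joshi-arxiv-2403.10430/`: Prop. 6.10.9 p.69 l.1–28; (6.11.1)–(6.11.2)
p.69 l.73 – p.70 l.29; Thm. 6.10.1 p.66 l.12–43; §7.1 p.73 l.9–35). FRAMING (binding): real-number bookkeeping on E-t33's typed antecedent;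
NO side is taken on [IUTchIII] Cor. 3.12 / [IUTchIV] Thm. 1.10, on Joshi's claims or on Mochizuki's report on them; NOT an abc claim — every
theorem is an implication from a residual antecedent that carries the whole diophantine content; typed ≠ proved ≠ endorsed. No `sorry`,
instance, notation, `def` or new `Prop`. [claim: Joshi2024ATS4, status: disputed] [claim: Mochizuki2012, status: disputed] (locators only).
-/

noncomputable section

namespace Summit.ABC.IUTFork.Joshi.ATS4
open Literature.NumberTheory.DiophantineGeometry Literature.NumberTheory.DiophantineGeometry.GenEll
open Literature.NumberTheory.EllipticCurves
open Literature.IUT.LogVolume Literature.IUT.LogVolume.Cor22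
open Literature.NumberTheory.LFunctions
open NumberField IsDedekindDomain Finset
open scoped Classical

/-! ## 1. (R4) ∧ (R5) are satisfiable in the volumes iff ONE vol-free inequality holds -/

/-- **ELIMINATION OF THE LOCAL HULL LOG-VOLUMES.** For `ℓ ≥ 2`, reals `B p` and `Q`: there exist `vol : ℕ → ℝ`, `vol_∞ : ℝ` with
(R4) `∀ p ∈ V, −(1/ℓ⋆)·|vol p| ≤ B p` and (R5) `−(1/2ℓ)·Q ≤ −(1/ℓ⋆)·(Σ_{p∈V} |vol p| + |vol_∞|)` IFF `Σ_{p∈V} max(0, −B p) ≤ (1/2ℓ)·Q`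
(`ℓ⋆ = (ℓ−1)/2`). Forwards: `max(0, −B p) ≤ (1/ℓ⋆)|vol p|`, sum, (R5). Backwards: `vol p := ℓ⋆·max(0, −B p)`, `vol_∞ := 0`. [folklore] -/
theorem residual_iff_volFree (ℓ : ℕ) (h2 : 2 ≤ ℓ) (V : Finset ℕ) (B : ℕ → ℝ) (Q : ℝ) :
    (∃ (vol : ℕ → ℝ) (volArch : ℝ), (∀ p ∈ V, -(1 / (((ℓ : ℝ) - 1) / 2)) * |vol p| ≤ B p) ∧
      -(1 / (2 * (ℓ : ℝ)) * Q) ≤ -(1 / (((ℓ : ℝ) - 1) / 2)) * (∑ p ∈ V, |vol p| + |volArch|)) ↔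
    ∑ p ∈ V, max 0 (-B p) ≤ 1 / (2 * (ℓ : ℝ)) * Q := by
  have hℓ : (2 : ℝ) ≤ ℓ := by exact_mod_cast h2
  have hL : 0 < ((ℓ : ℝ) - 1) / 2 := by linarith
  set L : ℝ := ((ℓ : ℝ) - 1) / 2 with hLdef
  constructor
  · rintro ⟨vol, volArch, hR4, hR5⟩
    have hterm : ∀ p ∈ V, max 0 (-B p) ≤ 1 / L * |vol p| := by
      intro p hp
      have h := hR4 p hp
      refine max_le (by positivity) ?_
      have : -(1 / L) * |vol p| = -(1 / L * |vol p|) := by ring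
      linarith
    calc ∑ p ∈ V, max 0 (-B p) ≤ ∑ p ∈ V, 1 / L * |vol p| := Finset.sum_le_sum hterm
      _ = 1 / L * ∑ p ∈ V, |vol p| := by rw [Finset.mul_sum]
      _ ≤ 1 / L * (∑ p ∈ V, |vol p| + |volArch|) := by
          refine mul_le_mul_of_nonneg_left (le_add_of_nonneg_right (abs_nonneg _)) (by positivity)
      _ ≤ 1 / (2 * (ℓ : ℝ)) * Q := by
          have : -(1 / L) * (∑ p ∈ V, |vol p| + |volArch|) = -(1 / L * (∑ p ∈ V, |vol p| + |volArch|)) := by ring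
          linarith
  · intro h
    refine ⟨fun p => L * max 0 (-B p), 0, fun p _ => ?_, ?_⟩
    · have hnn : 0 ≤ L * max 0 (-B p) := mul_nonneg hL.le (le_max_left _ _)
      rw [abs_of_nonneg hnn]
      have : -(1 / L) * (L * max 0 (-B p)) = -max 0 (-B p) := by field_simp
      rw [this, neg_le]
      exact le_max_right _ _
    · have hnn : ∀ p, 0 ≤ L * max 0 (-B p) := fun p => mul_nonneg hL.le (le_max_left _ _)
      simp only [abs_of_nonneg (hnn _), abs_zero, add_zero]
      rw [← Finset.mul_sum]
      have : -(1 / L) * (L * ∑ p ∈ V, max 0 (-B p)) = -∑ p ∈ V, max 0 (-B p) := by field_simp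
      rw [this]
      linarith

/-! ## 2. E-t33's ∃-form spine with (R4) ∧ (R5) replaced by the vol-free inequality -/

/-- **THE E5 SPINE, ∃-FORM, VOL-FREE RESIDUAL.** `abc_of_genuineResidual` holds with the local hull log-volumes `vol p`, `vol_∞` and
their two constraints (R4) «[IUTchIV] Step (v) per distinguished prime in Prop 6.10.9's shape» ∧ (R5) «the lower bound at φ(y₀)» REPLACED by
the single real inequality `Σ_{p∈V} max(0, −B p) ≤ (1/2ℓ)·log 𝔮_F`, `B p := ((ℓ+1)/4)·{(1+4/ℓ)·DLp p − (1/6)·qAt p + (4/ℓ)·log p +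
(20/3)·e*_mod·ι_p·(log p)/p}`. Derived from E-t33's theorem BY NAME through `residual_iff_volFree`: the volumes are FREE INTERMEDIARIES. PROVED AS AN
IMPLICATION; NO abc claim; no side taken. [claim: Joshi2024ATS4, status: disputed] -/
theorem abc_of_volFreeResidual
    (h : ∀ (d : ℕ), 0 < d → ∀ P ∈ UPle d, ∀ (ℓ : ℕ) (hℓ : ℓ.Prime) (h5 : 5 ≤ ℓ), IsLem587Prime d P ℓ → ITDConditions P ℓ →
      AdmitsCore P → Real.log (4 * (2 ^ 12 * 3 ^ 3 * 5 * (d : ℝ)) * ℓ) ≤ 4 / 3 * ℓ →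
        ∃ (F : Type) (_ : Field F) (_ : NumberField F) (_ : Algebra P.F F)
          (K : Type) (_ : Field K) (_ : NumberField K) (_ : Algebra F K) (_ : Algebra P.F K) (_ : IsScalarTower P.F F K)
          (_ : IsGalois F K) (ψ : K →ₐ[F] AlgebraicClosure F) (hU : P.InU) (_ : IsThetaField P F)
          (_ : letI := thetaCurve_isElliptic hU F
            ((thetaCurve P F).galoisRepTorsion (ℓ : ℤ)).ker ≤ ψ.fieldRange.fixingSubgroup)
          (_ : 0 < (TateDivisorDatum.ofNFPointOver P {2, ℓ} F).logq)
          (Lmod : Type) (_ : Field Lmod) (_ : NumberField Lmod) (_ : Cor22.dmod P ≤ dMod Lmod) (_ : dMod Lmod ≤ d)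
          (V : Finset ℕ)
          (_ : ∀ q ∈ V, q.Prime ∧ (q ∣ 2 * 3 * 5 * ℓ ∨ (∃ v ∈ badPlacesAvoid P {2, ℓ}, residueChar P.F v = q) ∨
            ∃ u : HeightOneSpectrum (𝓞 K), residueChar K u = q ∧ 2 ≤ u.asIdeal.ramificationIdx ℤ))
          (DLp qAt : ℕ → ℝ),
          (∑ p ∈ V, DLp p = logDifferent K) ∧ (∑ p ∈ V, qAt p = (TateDivisorDatum.ofNFPointOver P {2, ℓ} F).logq) ∧
          ∑ p ∈ V, max 0 (-(((ℓ : ℝ) + 1) / 4 *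
            ((1 + 4 / (ℓ : ℝ)) * DLp p - 1 / 6 * qAt p + 4 / (ℓ : ℝ) * Real.log p
              + 20 / 3 * ((2 ^ 12 * 3 ^ 3 * 5 * eMod Lmod : ℕ) : ℝ) *
                (if p ≤ 2 ^ 12 * 3 ^ 3 * 5 * eMod Lmod * ℓ then Real.log p / p else 0)))) ≤
            1 / (2 * (ℓ : ℝ)) * (TateDivisorDatum.ofNFPointOver P {2, ℓ} F).logq) : ABC := by
  refine abc_of_genuineResidual fun d hd P hP ℓ hℓ h5 hℓP hITD hcore hroom => ?_
  obtain ⟨F, _, _, _, K, _, _, _, _, _, _, ψ, hU, hF, hK, hq, Lmod, _, _, hmod, hdmod, V, hV, DLp, qAt, hDLp, hqAt, hfree⟩ :=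
    h d hd P hP ℓ hℓ h5 hℓP hITD hcore hroom
  obtain ⟨vol, volArch, hR4, hR5⟩ := (residual_iff_volFree ℓ (le_trans (by norm_num) h5) V _ _).mpr hfree
  exact ⟨F, inferInstance, inferInstance, inferInstance, K, inferInstance, inferInstance, inferInstance, inferInstance,
    inferInstance, inferInstance, ψ, hU, hF, hK, hq, Lmod, inferInstance, inferInstance, hmod, hdmod, V, hV, DLp, qAt, vol, volArch,
    hDLp, hqAt, hR4, hR5⟩

/-! ## 3. With FREE `d_{L′}`/`q` components (sums only), even the per-prime form collapses to ONE GLOBAL inequality -/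

/-- Balancing lemma: on a finite set `V ∋ p₀`, for any reals `c > 0`, target sum `D` and nonnegative `pos p`, the assignment
`x p := −pos p / c (p ≠ p₀)`, `x p₀ := D + Σ_{p ∈ V∖p₀} pos p / c` has `Σ_V x = D` and `c·x p + pos p = 0` off `p₀`. [folklore] -/
theorem sum_balance (V : Finset ℕ) {p₀ : ℕ} (hp₀ : p₀ ∈ V) (c D : ℝ) (pos : ℕ → ℝ) :
    ∑ p ∈ V, (if p = p₀ then D + ∑ q ∈ V.erase p₀, pos q / c else -(pos p / c)) = D := by
  rw [← Finset.add_sum_erase V _ hp₀, if_pos rfl]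
  have : ∑ p ∈ V.erase p₀, (if p = p₀ then D + ∑ q ∈ V.erase p₀, pos q / c else -(pos p / c)) =
      ∑ p ∈ V.erase p₀, -(pos p / c) :=
    Finset.sum_congr rfl fun p hp => by rw [if_neg (Finset.ne_of_mem_erase hp)]
  rw [this, Finset.sum_neg_distrib]
  ring

/-- **THE E5 SPINE, ∃-FORM, ONE GLOBAL INEQUALITY.** Because `abc_of_genuineResidual` types the `v_ℚ`-components `log d_{L′,p}`,
`log q_p` as FREE reals constrained only by their sums (R3), the supplier may BALANCE the per-prime positive terms away (choosing
`log d_{L′,p} < 0` off one prime — permitted by the typing, absurd for genuine components): its antecedent is implied by — and, `residual_iff_volFree` forwards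
plus summation, equivalent to — ONE GLOBAL real inequality per admissible point between GENUINE invariants of the tower and NO volume:
`−(1/2ℓ)·log 𝔮_F ≤ ((ℓ+1)/4)·{(1+4/ℓ)·logDifferent K − (1/6)·log 𝔮_F + (4/ℓ)·Σ_{p∈V} log p + (20/3)·e*_mod·Σ_{p∈V} ι_p·(log p)/p}` on a
non-empty three-way `V` — the summed Step (v) ∘ (6.11.1) ∘ lower bound ((6.11.2)'s shape; [IUTchIV] Thm 1.10's shape). So at FREE components
the ∃-form spine reads «a Thm-1.10-SHAPED global inequality at every admissible genuine tower ⟹ ABC» (the classical reduction E-t33's own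
`thm721_of_thm611OnLambdaLine` ∘ `abc_of_thm721` already is); the per-prime Step (v) shape survives only in the GENUINE-component variants
`abc_of_genuineResidualSupport` / `…_reading3` (positive-part form of `abc_of_volFreeResidual`). PROVED AS AN IMPLICATION; NO abc claim; no
side taken. [claim: Joshi2024ATS4, status: disputed] -/
theorem abc_of_globalInequality
    (h : ∀ (d : ℕ), 0 < d → ∀ P ∈ UPle d, ∀ (ℓ : ℕ) (hℓ : ℓ.Prime) (h5 : 5 ≤ ℓ), IsLem587Prime d P ℓ → ITDConditions P ℓ →
      AdmitsCore P → Real.log (4 * (2 ^ 12 * 3 ^ 3 * 5 * (d : ℝ)) * ℓ) ≤ 4 / 3 * ℓ →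
        ∃ (F : Type) (_ : Field F) (_ : NumberField F) (_ : Algebra P.F F)
          (K : Type) (_ : Field K) (_ : NumberField K) (_ : Algebra F K) (_ : Algebra P.F K) (_ : IsScalarTower P.F F K)
          (_ : IsGalois F K) (ψ : K →ₐ[F] AlgebraicClosure F) (hU : P.InU) (_ : IsThetaField P F)
          (_ : letI := thetaCurve_isElliptic hU F
            ((thetaCurve P F).galoisRepTorsion (ℓ : ℤ)).ker ≤ ψ.fieldRange.fixingSubgroup)
          (_ : 0 < (TateDivisorDatum.ofNFPointOver P {2, ℓ} F).logq)
          (Lmod : Type) (_ : Field Lmod) (_ : NumberField Lmod) (_ : Cor22.dmod P ≤ dMod Lmod) (_ : dMod Lmod ≤ d)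
          (V : Finset ℕ) (_ : V.Nonempty)
          (_ : ∀ q ∈ V, q.Prime ∧ (q ∣ 2 * 3 * 5 * ℓ ∨ (∃ v ∈ badPlacesAvoid P {2, ℓ}, residueChar P.F v = q) ∨
            ∃ u : HeightOneSpectrum (𝓞 K), residueChar K u = q ∧ 2 ≤ u.asIdeal.ramificationIdx ℤ)),
          -(1 / (2 * (ℓ : ℝ)) * (TateDivisorDatum.ofNFPointOver P {2, ℓ} F).logq) ≤
            ((ℓ : ℝ) + 1) / 4 *
              ((1 + 4 / (ℓ : ℝ)) * logDifferent K - 1 / 6 * (TateDivisorDatum.ofNFPointOver P {2, ℓ} F).logq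
                + 4 / (ℓ : ℝ) * ∑ p ∈ V, Real.log p
                + 20 / 3 * ((2 ^ 12 * 3 ^ 3 * 5 * eMod Lmod : ℕ) : ℝ) *
                  ∑ p ∈ V, (if p ≤ 2 ^ 12 * 3 ^ 3 * 5 * eMod Lmod * ℓ then Real.log p / p else 0))) : ABC := by
  refine abc_of_volFreeResidual fun d hd P hP ℓ hℓ h5 hℓP hITD hcore hroom => ?_
  obtain ⟨F, _, _, _, K, _, _, _, _, _, _, ψ, hU, hF, hK, hq, Lmod, _, _, hmod, hdmod, V, hVne, hV, hglob⟩ :=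
    h d hd P hP ℓ hℓ h5 hℓP hITD hcore hroom
  obtain ⟨p₀, hp₀⟩ := hVne
  have hℓpos : (0 : ℝ) < ℓ := by exact_mod_cast hℓ.pos
  -- opaque abbreviations (genuinely new fvars with defining equations)
  obtain ⟨Q, hQ⟩ : ∃ Q : ℝ, Q = (TateDivisorDatum.ofNFPointOver P {2, ℓ} F).logq := ⟨_, rfl⟩
  obtain ⟨E, hE⟩ : ∃ E : ℝ, E = ((2 ^ 12 * 3 ^ 3 * 5 * eMod Lmod : ℕ) : ℝ) := ⟨_, rfl⟩
  obtain ⟨c, hc⟩ : ∃ c : ℝ, c = 1 + 4 / (ℓ : ℝ) := ⟨_, rfl⟩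
  obtain ⟨pos, hpos⟩ : ∃ pos : ℕ → ℝ, ∀ p, pos p = 4 / (ℓ : ℝ) * Real.log p
      + 20 / 3 * E * (if p ≤ 2 ^ 12 * 3 ^ 3 * 5 * eMod Lmod * ℓ then Real.log p / p else 0) := ⟨fun p => _, fun p => rfl⟩
  have hcpos : 0 < c := by rw [hc]; positivity
  have hcne : c ≠ 0 := hcpos.ne'
  -- balanced components: off `p₀` the bracket vanishes; at `p₀` it is the GLOBAL bracket
  obtain ⟨DLp, hDLp⟩ : ∃ DLp : ℕ → ℝ, ∀ p, DLp p =
      if p = p₀ then logDifferent K + ∑ q ∈ V.erase p₀, pos q / c else -(pos p / c) := ⟨fun p => _, fun p => rfl⟩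
  obtain ⟨qAt, hqAt⟩ : ∃ qAt : ℕ → ℝ, ∀ p, qAt p = if p = p₀ then Q else 0 := ⟨fun p => _, fun p => rfl⟩
  have hsumD : ∑ p ∈ V, DLp p = logDifferent K := by
    rw [Finset.sum_congr rfl fun p _ => hDLp p]
    exact sum_balance V hp₀ c _ pos
  have hsumQ : ∑ p ∈ V, qAt p = (TateDivisorDatum.ofNFPointOver P {2, ℓ} F).logq := by
    rw [Finset.sum_congr rfl fun p _ => hqAt p, Finset.sum_ite_eq' V p₀ (fun _ => Q), if_pos hp₀, hQ]
  refine ⟨F, inferInstance, inferInstance, inferInstance, K, inferInstance, inferInstance, inferInstance, inferInstance,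
    inferInstance, inferInstance, ψ, hU, hF, hK, hq, Lmod, inferInstance, inferInstance, hmod, hdmod, V, hV, DLp, qAt,
    hsumD, hsumQ, ?_⟩
  -- rewrite the target's brackets into the `c * DLp p - 1/6 * qAt p + pos p` shape
  have hshape : ∀ p, ((ℓ : ℝ) + 1) / 4 * ((1 + 4 / (ℓ : ℝ)) * DLp p - 1 / 6 * qAt p + 4 / (ℓ : ℝ) * Real.log p
      + 20 / 3 * ((2 ^ 12 * 3 ^ 3 * 5 * eMod Lmod : ℕ) : ℝ) *
        (if p ≤ 2 ^ 12 * 3 ^ 3 * 5 * eMod Lmod * ℓ then Real.log p / p else 0)) =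
      ((ℓ : ℝ) + 1) / 4 * (c * DLp p - 1 / 6 * qAt p + pos p) := by
    intro p; rw [hpos p, hc, hE]; ring
  have hoff : ∀ p ∈ V.erase p₀, ((ℓ : ℝ) + 1) / 4 * (c * DLp p - 1 / 6 * qAt p + pos p) = 0 := by
    intro p hp
    have hne : p ≠ p₀ := Finset.ne_of_mem_erase hp
    rw [hDLp p, hqAt p, if_neg hne, if_neg hne]
    field_simp
    ring
  have hat : ((ℓ : ℝ) + 1) / 4 * (c * DLp p₀ - 1 / 6 * qAt p₀ + pos p₀) =
      ((ℓ : ℝ) + 1) / 4 * (c * logDifferent K - 1 / 6 * Q + ∑ p ∈ V, pos p) := by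
    rw [hDLp p₀, hqAt p₀, if_pos rfl, if_pos rfl, ← Finset.add_sum_erase V pos hp₀]
    have : c * (logDifferent K + ∑ q ∈ V.erase p₀, pos q / c) = c * logDifferent K + ∑ q ∈ V.erase p₀, pos q := by
      rw [mul_add, Finset.mul_sum]
      congr 1
      exact Finset.sum_congr rfl fun q _ => by field_simp
    rw [this]
    ring
  simp_rw [hshape]
  rw [← Finset.add_sum_erase V _ hp₀, hat]
  have hrest : ∑ p ∈ V.erase p₀, max 0 (-(((ℓ : ℝ) + 1) / 4 * (c * DLp p - 1 / 6 * qAt p + pos p))) = 0 :=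
    Finset.sum_eq_zero fun p hp => by rw [hoff p hp, neg_zero, max_self]
  rw [hrest, add_zero]
  -- the global inequality says exactly `−(global bracket) ≤ (1/2ℓ)·Q`, and `(1/2ℓ)·Q ≥ 0`
  have hQpos : 0 < Q := by rw [hQ]; exact hq
  have hQnn : 0 ≤ 1 / (2 * (ℓ : ℝ)) * Q := by positivity
  rw [← hQ]
  refine max_le hQnn ?_
  have hsum : ∑ p ∈ V, pos p = 4 / (ℓ : ℝ) * ∑ p ∈ V, Real.log p
      + 20 / 3 * E * ∑ p ∈ V, (if p ≤ 2 ^ 12 * 3 ^ 3 * 5 * eMod Lmod * ℓ then Real.log p / p else 0) := by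
    rw [Finset.sum_congr rfl fun p _ => hpos p, Finset.sum_add_distrib, ← Finset.mul_sum, ← Finset.mul_sum]
  rw [hsum, hc]
  rw [← hQ, ← hE] at hglob
  linarith

/-! ## 3b. The same elimination at GENUINE components (E-t33's `abc_of_genuineResidualSupport`) -/

/-- **THE E5 SPINE, ∃-FORM, VOL-FREE RESIDUAL AT GENUINE COMPONENTS.** E-t33's `abc_of_genuineResidualSupport` (the `v_ℚ`-components of
`log d_{L′}` and `log 𝔮_F` READ GENUINELY as E-t35's fibre sums; (R3) ↦ the support conditions) holds with the local hull log-volumes and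
(R4′) ∧ (R5) REPLACED by the per-prime positive-part sum `Σ_{p∈V} max(0, −B_p^{gen}) ≤ (1/2ℓ)·log 𝔮_F` at the GENUINE brackets `B_p^{gen}` —
`residual_iff_volFree` again; here no balancing is available, so the per-prime Step (v) SHAPE stays load-bearing (as a positive part).
PROVED AS AN IMPLICATION; NO abc claim; no side taken. [claim: Joshi2024ATS4, status: disputed] -/
theorem abc_of_volFreeResidualSupport
    (h : ∀ (d : ℕ), 0 < d → ∀ P ∈ UPle d, ∀ (ℓ : ℕ) (hℓ : ℓ.Prime) (h5 : 5 ≤ ℓ), IsLem587Prime d P ℓ → ITDConditions P ℓ →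
      AdmitsCore P → Real.log (4 * (2 ^ 12 * 3 ^ 3 * 5 * (d : ℝ)) * ℓ) ≤ 4 / 3 * ℓ →
        ∃ (F : Type) (_ : Field F) (_ : NumberField F) (_ : Algebra P.F F)
          (K : Type) (_ : Field K) (_ : NumberField K) (_ : Algebra F K) (_ : Algebra P.F K) (_ : IsScalarTower P.F F K)
          (_ : IsGalois F K) (ψ : K →ₐ[F] AlgebraicClosure F) (hU : P.InU) (_ : IsThetaField P F)
          (_ : letI := thetaCurve_isElliptic hU F
            ((thetaCurve P F).galoisRepTorsion (ℓ : ℤ)).ker ≤ ψ.fieldRange.fixingSubgroup)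
          (_ : 0 < (TateDivisorDatum.ofNFPointOver P {2, ℓ} F).logq)
          (Lmod : Type) (_ : Field Lmod) (_ : NumberField Lmod) (_ : Cor22.dmod P ≤ dMod Lmod) (_ : dMod Lmod ≤ d)
          (V : Finset ℕ)
          (_ : ∀ q ∈ V, q.Prime ∧ (q ∣ 2 * 3 * 5 * ℓ ∨ (∃ v ∈ badPlacesAvoid P {2, ℓ}, residueChar P.F v = q) ∨
            ∃ u : HeightOneSpectrum (𝓞 K), residueChar K u = q ∧ 2 ≤ u.asIdeal.ramificationIdx ℤ))
          (_ : ∀ u : HeightOneSpectrum (𝓞 K), 2 ≤ u.asIdeal.ramificationIdx ℤ → residueChar K u ∈ V)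
          (_ : ∀ w ∈ (TateDivisorDatum.ofNFPointOver P {2, ℓ} F).V, residueChar F w ∈ V)
          (DK : Finset (HeightOneSpectrum (𝓞 K))) (_ : ∀ u, differentDivisor K (Sum.inr u) ≠ 0 → u ∈ DK),
          ∑ p ∈ V, max 0 (-(((ℓ : ℝ) + 1) / 4 *
            ((1 + 4 / (ℓ : ℝ)) *
                ((Module.finrank ℚ K : ℝ)⁻¹ *
                  ∑ u ∈ DK with residueChar K u = p, differentDivisor K (Sum.inr u) * logNorm K u)
              - 1 / 6 *
                ((Module.finrank ℚ F : ℝ)⁻¹ *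
                  ∑ w ∈ (TateDivisorDatum.ofNFPointOver P {2, ℓ} F).V with residueChar F w = p,
                    (TateDivisorDatum.ofNFPointOver P {2, ℓ} F).tateDivisor (Sum.inr w) * logNorm F w)
              + 4 / (ℓ : ℝ) * Real.log p
              + 20 / 3 * ((2 ^ 12 * 3 ^ 3 * 5 * eMod Lmod : ℕ) : ℝ) *
                (if p ≤ 2 ^ 12 * 3 ^ 3 * 5 * eMod Lmod * ℓ then Real.log p / p else 0)))) ≤
            1 / (2 * (ℓ : ℝ)) * (TateDivisorDatum.ofNFPointOver P {2, ℓ} F).logq) : ABC := by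
  refine abc_of_genuineResidualSupport fun d hd P hP ℓ hℓ h5 hℓP hITD hcore hroom => ?_
  obtain ⟨F, _, _, _, K, _, _, _, _, _, _, ψ, hU, hF, hK, hq, Lmod, _, _, hmod, hdmod, V, hV, hram, hbad, DK, hDK, hfree⟩ :=
    h d hd P hP ℓ hℓ h5 hℓP hITD hcore hroom
  obtain ⟨vol, volArch, hR4, hR5⟩ := (residual_iff_volFree ℓ (le_trans (by norm_num) h5) V _ _).mpr hfree
  exact ⟨F, inferInstance, inferInstance, inferInstance, K, inferInstance, inferInstance, inferInstance, inferInstance,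
    inferInstance, inferInstance, ψ, hU, hF, hK, hq, Lmod, inferInstance, inferInstance, hmod, hdmod, V, hV, hram, hbad, DK, hDK,
    vol, volArch, hR4, hR5⟩

/-! ## 4. Conversely: the residual package implies the global inequality (so the two antecedents are EQUIVALENT) -/

/-- **(R3) ∧ (R4) ∧ (R5) ⟹ the GLOBAL inequality** — sum Step (v) over `V`, insert the component sums, and chain with the lower bound
(`|vol_∞| ≥ 0`). Together with `abc_of_globalInequality`'s construction this makes the residual antecedent of `abc_of_genuineResidual` and the
one-global-inequality antecedent EQUIVALENT per point (free components). Pure real arithmetic; PROVED. [folklore] -/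
theorem globalInequality_of_residual (ℓ : ℕ) (h2 : 2 ≤ ℓ) (V : Finset ℕ) (DLp qAt vol : ℕ → ℝ) (volArch LD Q E : ℝ) (N : ℕ)
    (hDLp : ∑ p ∈ V, DLp p = LD) (hqAt : ∑ p ∈ V, qAt p = Q)
    (hStepV : ∀ p ∈ V, -(1 / (((ℓ : ℝ) - 1) / 2)) * |vol p| ≤ ((ℓ : ℝ) + 1) / 4 *
      ((1 + 4 / (ℓ : ℝ)) * DLp p - 1 / 6 * qAt p + 4 / (ℓ : ℝ) * Real.log p
        + 20 / 3 * E * (if p ≤ N then Real.log p / p else 0)))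
    (hLower : -(1 / (2 * (ℓ : ℝ)) * Q) ≤ -(1 / (((ℓ : ℝ) - 1) / 2)) * (∑ p ∈ V, |vol p| + |volArch|)) :
    -(1 / (2 * (ℓ : ℝ)) * Q) ≤ ((ℓ : ℝ) + 1) / 4 *
      ((1 + 4 / (ℓ : ℝ)) * LD - 1 / 6 * Q + 4 / (ℓ : ℝ) * ∑ p ∈ V, Real.log p
        + 20 / 3 * E * ∑ p ∈ V, (if p ≤ N then Real.log p / p else 0)) := by
  have hℓ : (2 : ℝ) ≤ ℓ := by exact_mod_cast h2
  have hL : 0 < ((ℓ : ℝ) - 1) / 2 := by linarith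
  -- sum Step (v) over `V`
  have hsum : ∑ p ∈ V, -(1 / (((ℓ : ℝ) - 1) / 2)) * |vol p| ≤ ∑ p ∈ V, ((ℓ : ℝ) + 1) / 4 *
      ((1 + 4 / (ℓ : ℝ)) * DLp p - 1 / 6 * qAt p + 4 / (ℓ : ℝ) * Real.log p
        + 20 / 3 * E * (if p ≤ N then Real.log p / p else 0)) := Finset.sum_le_sum hStepV
  have hlhs : ∑ p ∈ V, -(1 / (((ℓ : ℝ) - 1) / 2)) * |vol p| = -(1 / (((ℓ : ℝ) - 1) / 2)) * ∑ p ∈ V, |vol p| := by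
    rw [Finset.mul_sum]
  have hrhs : ∑ p ∈ V, ((ℓ : ℝ) + 1) / 4 *
      ((1 + 4 / (ℓ : ℝ)) * DLp p - 1 / 6 * qAt p + 4 / (ℓ : ℝ) * Real.log p
        + 20 / 3 * E * (if p ≤ N then Real.log p / p else 0)) =
      ((ℓ : ℝ) + 1) / 4 * ((1 + 4 / (ℓ : ℝ)) * LD - 1 / 6 * Q + 4 / (ℓ : ℝ) * ∑ p ∈ V, Real.log p
        + 20 / 3 * E * ∑ p ∈ V, (if p ≤ N then Real.log p / p else 0)) := by
    rw [← Finset.mul_sum, Finset.sum_add_distrib, Finset.sum_add_distrib, Finset.sum_sub_distrib, ← Finset.mul_sum, ← Finset.mul_sum,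
      ← Finset.mul_sum, ← Finset.mul_sum, hDLp, hqAt]
  rw [hlhs, hrhs] at hsum
  -- chain with the lower bound, dropping `|vol_∞| ≥ 0`
  have hdrop : -(1 / (((ℓ : ℝ) - 1) / 2)) * (∑ p ∈ V, |vol p| + |volArch|) ≤ -(1 / (((ℓ : ℝ) - 1) / 2)) * ∑ p ∈ V, |vol p| := by
    have h0 : 0 ≤ |volArch| := abs_nonneg _
    have h1 : 0 < 1 / (((ℓ : ℝ) - 1) / 2) := by positivity
    nlinarith
  exact hLower.trans (hdrop.trans hsum)

end Summit.ABC.IUTFork.Joshi.ATS4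

end
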